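import Literature.MathematicalPhysics.QuantumFieldTheory.Balaban1983to89.B6DeltaPrime2109Torus
import Literature.MathematicalPhysics.QuantumFieldTheory.Balaban1983to89.B4Block227
import Literature.MathematicalPhysics.QuantumFieldTheory.Balaban1983to89.B5Blocks16

/-!
# `Balaban1983to89.B6DeltaPrime2110Torus` — T. Bałaban, *Propagators and renormalization transformations for lattice gauge
# theories. II*, Commun. Math. Phys. **96** (1984) 223–250 [Balaban1984PropagatorsII], (2.110) p.242: the form window
# `γ₀‖ω‖² ≤ ⟨ω, Δ′_jω⟩ ≤ γ₁‖ω‖²` on `Q′₁ω = 0` for the typed torus `Δ′_j`, with `γ₀, γ₁` depending on d and L only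

statement-level skeleton of published theorems with citation tags; proofs where landed; nothing here is a claim about the Yang–Mills mass gap

PDF held: `paper:balaban1984-cmp96-propagators-rt-ii` (journal page = PDF page + 222); p. 242 [PDF 20] read.

CITATION HEADER (lean-in-tree rule).  WHAT IS REPRODUCED: lit-balaban SKELETON row **B6.Eq2.110** ((2.110) p. 242), verbatim:
*"Now let us consider the integral with respect to ω. We integrate over the functions satisfying the restriction Q′₁ω = 0,
and then we have ‖Δ₀ω‖² ≥ γ₀‖ω‖² with γ₀ > 0 (we can take γ₀ = π²/L² in fact). Hence γ₀‖ω‖² ≤ ⟨ω, Δ′_jω⟩ ≤ γ₁‖ω‖² for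
ω : Q′₁ω = 0, (2.110) with positive constants γ₀, γ₁ dependent on d and L only."*  State of the tree: the (2.109) window
`c₀‖Δ₀ω‖² ≤ ⟨ω, Δ′_jω⟩ ≤ c₁‖Δ₀ω‖² ≤ γ₁‖ω‖²` for the TYPED torus operator `Δ′_j = B6Hprime2101TorusAlgebra.dPOp` is a theorem for
every ω (`B6DeltaPrime2109Torus.ineq2109`, r03 g6 p255308); row B6.Eq2.110's use site (S2) takes the window (2.110) as a
HYPOTHESIS (`B6Elimination.LowerOnKer`).  THIS FILE proves (2.110) AS PRINTED for the typed operator on the unit torus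
`T = Π_μ ℤ/(L·M_μ)` with `Q′₁` = the averaging over the L-blocks of T (`B5Block118.QsOp L M`): for every ω with `Q′₁ω = 0`,
`γ₀‖ω‖² ≤ ⟨ω, Δ′_jω⟩ ≤ γ₁‖ω‖²`, `γ₀ = c₀(d)·(8/L²)²`, `γ₁ = γ₁(d)` — constants depending on d and L only, uniform in the fine
factor `n = L^{j−1}` above T and in the torus.  The paper's route is followed: a Poincaré inequality on `Q′₁ω = 0`
(*"‖Δ₀ω‖² ≥ γ₀‖ω‖²"* — here `‖∇ω‖² ≥ (8/L²)‖ω‖²` blockwise from [Balaban1983RegularityDecay] (2.27) in the cell's repaired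
form `B4Block227.sum_sq_le_of_sum_eq_zero_coordCube8` (constant 8; the printed π² of (2.27)/(2.11) is refuted in the cell,
GAPS G-B6-13), upgraded to `‖Δ₀ω‖² ≥ (8/L²)²‖ω‖²` by Cauchy–Schwarz `⟨ω, Δ₀ω⟩² ≤ ‖Δ₀ω‖²‖ω‖²`), then (2.109).
Unit `lit-balaban-r03` (B6 reader/owner, gen 6; own lineage `B6DeltaPrime2109Torus`/`B6Hprime2101TorusAlgebra`), PHASE 2
(G.2(b) knitting), HOME `run/shared/lean/pub/lit-balaban/`, 2026-08-21.  IMPORTS `…B6DeltaPrime2109Torus`, `…B4Block227`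
(the block Poincaré engine), `…B5Blocks16` (`bpt_bijective`: the torus is the disjoint union of its blocks) — BY NAME; no new
definition, no new named fact (theorems only).

## Content (sorry-free; `[cite: …]` tags are TEXT LOCATIONS; the mathematics is `[folklore]` Poincaré/Plancherel bookkeeping)

* §1 `bpt_stepUp` (an in-block step is a torus step), `sum_blocks` (block decomposition of torus sums),
  **`block_poincare_real` / `block_poincare`**: `8‖ω‖² ≤ L²·⟨ω, Δ₀ω⟩ = L²‖∇ω‖²` for every ω with zero L-block sums.
* §2 `form_LapS_momentum`, `form_LapS_sq_le` (Cauchy–Schwarz `⟨ω, Δ₀ω⟩² ≤ ‖Δ₀ω‖²·‖ω‖²` in momentum space).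
* §3 **`ineq2110_lower`, `ineq2110_upper`, `ineq2110`** — (2.110) for the typed operator; `blockSum_eq_zero_of_QsOp` (the
  hypothesis `Q′₁ω = 0` in operator form).

## Honest scope

(i) TORUS MODEL (finite periodic unit lattice), complex ω, `U = 1`.  (ii) γ₀ = c₀(d)·64/L⁴ — the print's *"we can take
γ₀ = π²/L² in fact"* is NOT claimed (its π² is the refuted constant of (2.11)/(2.27); and the displayed Poincaré is for
‖Δ₀ω‖² with Δ₀ the Laplacian, so the honest exponent of L from this route is 4, not 2 — the print's sentence *"dependent on d
and L only"* is what is certified).  (iii) The (S2) use site (`B6Elimination.site242_uniform`, regions Λ ⊂ ℤ^d, real kernels)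
is not re-instantiated here.  (iv) Value = kernel certificate of bookkeeping for a located, asserted display of
[Balaban1984PropagatorsII]; NOT summit progress, NOT continuum, NOT Clay.
-/

open scoped BigOperators Matrix ComplexConjugate Real
open Finset Complex

namespace Literature.MathematicalPhysics.QuantumFieldTheory.Balaban1983to89.B6DeltaPrime2110Torus

open Literature.MathematicalPhysics.QuantumFieldTheory.Balaban1983to89.B4Strip (Delta1r Delta1r_nonneg)
open Literature.MathematicalPhysics.QuantumFieldTheory.Balaban1983to89.B5Prop11Plancherel (Tor dft fine sOf unitVec)
open Literature.MathematicalPhysics.QuantumFieldTheory.Balaban1983to89.B5Action121 (LapS sdiff sdiff_mulVec)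
open Literature.MathematicalPhysics.QuantumFieldTheory.Balaban1983to89.B5Block118 (bpt up iota QsOp QsOp_mulVec)
open Literature.MathematicalPhysics.QuantumFieldTheory.Balaban1983to89.B5Blocks16 (bpt_bijective)
open Literature.MathematicalPhysics.QuantumFieldTheory.Balaban1983to89.B5LaplaceSpectral (form_LapS)
open Literature.MathematicalPhysics.QuantumFieldTheory.Balaban1983to89.Beta.CoordCubePoincare (stepUp)
open Literature.MathematicalPhysics.QuantumFieldTheory.Balaban1983to89.B4Block227 (sum_sq_le_of_sum_eq_zero_coordCube8)
open Literature.MathematicalPhysics.QuantumFieldTheory.Balaban1983to89.B6Hprime2101 (c0_2109 c1_2109 gamma1_2109 c0_2109_pos)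
open Literature.MathematicalPhysics.QuantumFieldTheory.Balaban1983to89.B6Hprime2101TorusAlgebra (dPOp)
open Literature.MathematicalPhysics.QuantumFieldTheory.Balaban1983to89.B6DeltaPrime2109Torus (dot_eq_dot_dft lsym_one_eq
  norm_sq_eq norm_LapS_sq ineq2109_lower ineq2109_upper ineq2109_top)

noncomputable section

variable {d : ℕ}

/-! ## §1. The block Poincaré inequality on the torus: `8‖ω‖² ≤ L²‖∇ω‖²` on `Q′₁ω = 0` -/

section Blocks

variable (k : ℕ) (M : Fin d → ℕ) [hM : ∀ μ, NeZero (M μ)]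

omit hM in
/-- an in-block step in direction μ (offset `j → j + e_μ`, `j_μ` not maximal) is the torus step `x → x + e_μ`.
[cite: Balaban1984PropagatorsI, (1.6) p.18] [folklore] -/
theorem bpt_stepUp (y : Tor M) (j : Fin d → Fin (k + 1)) (μ : Fin d) (hj : j μ ≠ Fin.last k) :
    bpt (k + 1) M y (stepUp j μ) = bpt (k + 1) M y j + unitVec (fine (k + 1) M) μ := by
  funext ν
  simp only [bpt, iota, stepUp, unitVec, Pi.add_apply]
  by_cases h : ν = μ
  · subst h
    rw [Function.update_self, Pi.single_eq_same, Fin.val_add_one_of_lt (Fin.lt_last_iff_ne_last.mpr hj)]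
    push_cast
    ring
  · rw [Function.update_of_ne h, Pi.single_eq_of_ne h, add_zero]

/-- block decomposition of a torus sum: `Σ_x G(x) = Σ_y Σ_j G(L·y + j)` (`B5Blocks16.bpt_bijective`).
[cite: Balaban1984PropagatorsI, (1.6) p.18] [folklore] -/
theorem sum_blocks (G : Tor (fine (k + 1) M) → ℝ) :
    ∑ x, G x = ∑ y : Tor M, ∑ j : Fin d → Fin (k + 1), G (bpt (k + 1) M y j) := by
  rw [← (bpt_bijective (k + 1) M).sum_comp G, Fintype.sum_prod_type]

/-- **THE BLOCK POINCARÉ INEQUALITY ON THE TORUS, real form**: for `g : T → ℝ` with vanishing sums over every L-block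
(`L = k + 1`), `8·Σ_x g(x)² ≤ L²·Σ_x Σ_μ (g(x + e_μ) − g(x))²` — [Balaban1983RegularityDecay] (2.27) block by block
(`B4Block227.sum_sq_le_of_sum_eq_zero_coordCube8`, constant 8), the inter-block bonds dropped ((2.26)).
[cite: Balaban1984PropagatorsII, (2.110) p.242 «‖Δ₀ω‖² ≥ γ₀‖ω‖²»; Balaban1983RegularityDecay (2.26)–(2.27) p.580] -/
theorem block_poincare_real (g : Tor (fine (k + 1) M) → ℝ)
    (hg : ∀ y : Tor M, ∑ j : Fin d → Fin (k + 1), g (bpt (k + 1) M y j) = 0) :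
    8 * ∑ x, g x ^ 2 ≤ ((k : ℝ) + 1) ^ 2 * ∑ x, ∑ μ, (g (x + unitVec (fine (k + 1) M) μ) - g x) ^ 2 := by
  rw [sum_blocks k M (fun x => g x ^ 2),
    sum_blocks k M (fun x => ∑ μ, (g (x + unitVec (fine (k + 1) M) μ) - g x) ^ 2),
    Finset.mul_sum, Finset.mul_sum]
  refine Finset.sum_le_sum fun y _ => ?_
  have hP := sum_sq_le_of_sum_eq_zero_coordCube8 k d (fun j => g (bpt (k + 1) M y j)) (hg y)
  have hsub : ∑ μ : Fin d, ∑ j ∈ Finset.univ.filter (fun j : Fin d → Fin (k + 1) => j μ ≠ Fin.last k),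
        (g (bpt (k + 1) M y (stepUp j μ)) - g (bpt (k + 1) M y j)) ^ 2
      ≤ ∑ μ : Fin d, ∑ j : Fin d → Fin (k + 1),
          (g (bpt (k + 1) M y j + unitVec (fine (k + 1) M) μ) - g (bpt (k + 1) M y j)) ^ 2 := by
    refine Finset.sum_le_sum fun μ _ => ?_
    calc ∑ j ∈ Finset.univ.filter (fun j : Fin d → Fin (k + 1) => j μ ≠ Fin.last k),
          (g (bpt (k + 1) M y (stepUp j μ)) - g (bpt (k + 1) M y j)) ^ 2
        = ∑ j ∈ Finset.univ.filter (fun j : Fin d → Fin (k + 1) => j μ ≠ Fin.last k),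
          (g (bpt (k + 1) M y j + unitVec (fine (k + 1) M) μ) - g (bpt (k + 1) M y j)) ^ 2 :=
          Finset.sum_congr rfl fun j hj => by rw [bpt_stepUp k M y j μ (Finset.mem_filter.mp hj).2]
      _ ≤ _ := Finset.sum_le_sum_of_subset_of_nonneg (Finset.filter_subset _ _) fun j _ _ => sq_nonneg _
  have hcomm : ∑ μ : Fin d, ∑ j : Fin d → Fin (k + 1),
        (g (bpt (k + 1) M y j + unitVec (fine (k + 1) M) μ) - g (bpt (k + 1) M y j)) ^ 2
      = ∑ j : Fin d → Fin (k + 1), ∑ μ : Fin d,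
        (g (bpt (k + 1) M y j + unitVec (fine (k + 1) M) μ) - g (bpt (k + 1) M y j)) ^ 2 := Finset.sum_comm
  have hK : (0 : ℝ) ≤ ((k : ℝ) + 1) ^ 2 := by positivity
  calc 8 * ∑ j : Fin d → Fin (k + 1), g (bpt (k + 1) M y j) ^ 2
      ≤ 8 * (((k : ℝ) + 1) ^ 2 / 8 * ∑ μ : Fin d,
          ∑ j ∈ Finset.univ.filter (fun j : Fin d → Fin (k + 1) => j μ ≠ Fin.last k),
            (g (bpt (k + 1) M y (stepUp j μ)) - g (bpt (k + 1) M y j)) ^ 2) :=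
        mul_le_mul_of_nonneg_left hP (by norm_num)
    _ = ((k : ℝ) + 1) ^ 2 * ∑ μ : Fin d,
          ∑ j ∈ Finset.univ.filter (fun j : Fin d → Fin (k + 1) => j μ ≠ Fin.last k),
            (g (bpt (k + 1) M y (stepUp j μ)) - g (bpt (k + 1) M y j)) ^ 2 := by ring
    _ ≤ ((k : ℝ) + 1) ^ 2 * ∑ μ : Fin d, ∑ j : Fin d → Fin (k + 1),
          (g (bpt (k + 1) M y j + unitVec (fine (k + 1) M) μ) - g (bpt (k + 1) M y j)) ^ 2 :=
        mul_le_mul_of_nonneg_left hsub hK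
    _ = _ := by rw [hcomm]

/-- `‖v‖² = Σ_x (Re v(x))² + (Im v(x))²` for the plain pairing `star v ⬝ᵥ v`. [folklore] -/
private theorem re_star_dot_self {ι : Type*} [Fintype ι] (v : ι → ℂ) :
    (star v ⬝ᵥ v).re = ∑ x, ((v x).re ^ 2 + (v x).im ^ 2) := by
  rw [dotProduct, Complex.re_sum]
  refine Finset.sum_congr rfl fun x _ => ?_
  rw [Pi.star_apply, Complex.star_def, Complex.mul_re, Complex.conj_re, Complex.conj_im]
  ring

/-- `⟨ω, Δ₀ω⟩ = ‖∇ω‖² = Σ_x Σ_μ |ω(x + e_μ) − ω(x)|²` (real part; the form is real) for the unit Laplacian `LapS _ 1`.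
[cite: Balaban1984PropagatorsII, (2.8)–(2.11) pp.224–225 (Δ = ∂*∂)] [folklore] -/
theorem re_form_LapS_eq {N : Fin d → ℕ} [∀ μ, NeZero (N μ)] (ω : Tor N → ℂ) :
    (star ω ⬝ᵥ (LapS N 1 *ᵥ ω)).re
      = ∑ x, ∑ μ, (((ω (x + unitVec N μ)).re - (ω x).re) ^ 2 + ((ω (x + unitVec N μ)).im - (ω x).im) ^ 2) := by
  rw [form_LapS, Complex.re_sum, Finset.sum_comm]
  refine Finset.sum_congr rfl fun μ _ => ?_
  rw [re_star_dot_self]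
  refine Finset.sum_congr rfl fun x _ => ?_
  rw [sdiff_mulVec, one_mul, Complex.sub_re, Complex.sub_im]

/-- **THE BLOCK POINCARÉ INEQUALITY ON THE TORUS**: for every `ω : T → ℂ` with `Σ_{x∈B(y)} ω(x) = 0` for all L-blocks
`B(y)` (i.e. `Q′₁ω = 0`), `8‖ω‖² ≤ L²⟨ω, Δ₀ω⟩ = L²‖∇ω‖²` (`L = k + 1`). [cite: Balaban1984PropagatorsII, (2.110) p.242 «we have ‖Δ₀ω‖² ≥ γ₀‖ω‖² with γ₀ > 0»; Balaban1983RegularityDecay (2.27) p.580] -/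
theorem block_poincare (ω : Tor (fine (k + 1) M) → ℂ)
    (hω : ∀ y : Tor M, ∑ j : Fin d → Fin (k + 1), ω (bpt (k + 1) M y j) = 0) :
    8 * (star ω ⬝ᵥ ω).re ≤ ((k : ℝ) + 1) ^ 2 * (star ω ⬝ᵥ (LapS (fine (k + 1) M) 1 *ᵥ ω)).re := by
  have hre := block_poincare_real k M (fun x => (ω x).re) fun y => by
    have h := congrArg Complex.re (hω y); rwa [Complex.re_sum, Complex.zero_re] at h
  have him := block_poincare_real k M (fun x => (ω x).im) fun y => by
    have h := congrArg Complex.im (hω y); rwa [Complex.im_sum, Complex.zero_im] at h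
  rw [re_star_dot_self, re_form_LapS_eq]
  simp only [Finset.sum_add_distrib, mul_add] at hre him ⊢
  linarith

/-- the hypothesis `Q′₁ω = 0` in operator form: `QsOp L M ω = 0` iff all L-block sums of ω vanish.
[cite: Balaban1984PropagatorsI, (1.20) p.20] [folklore] -/
theorem blockSum_eq_zero_of_QsOp (ω : Tor (fine (k + 1) M) → ℂ) (h : QsOp (k + 1) M *ᵥ ω = 0) (y : Tor M) :
    ∑ j : Fin d → Fin (k + 1), ω (bpt (k + 1) M y j) = 0 := by
  have hy := congrFun h y
  rw [QsOp_mulVec, Pi.zero_apply] at hy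
  have hc : (1 / ((k + 1 : ℕ) : ℂ) ^ d) ≠ 0 := by
    apply one_div_ne_zero
    exact pow_ne_zero _ (by exact_mod_cast Nat.succ_ne_zero k)
  exact (mul_eq_zero.mp hy).resolve_left hc

end Blocks

/-! ## §2. Cauchy–Schwarz in momentum space: `⟨ω, Δ₀ω⟩² ≤ ‖Δ₀ω‖²‖ω‖²` -/

section Momentum

variable (N : Fin d → ℕ) [hN : ∀ μ, NeZero (N μ)]

/-- `⟨ω, Δ₀ω⟩ = Σ_q Δ₀(p′)|ω̂(q)|²`. [cite: Balaban1984PropagatorsII, (2.108) p.242 «In momentum representation on the unit lattice»] [folklore] -/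
theorem form_LapS_momentum (ω : Tor N → ℂ) :
    star ω ⬝ᵥ (LapS N 1 *ᵥ ω) = ((∑ q, Delta1r 0 (sOf N q) * ‖(dft N *ᵥ ω) q‖ ^ 2 : ℝ) : ℂ) := by
  have h : dft N *ᵥ (LapS N 1 *ᵥ ω) = fun q => B5LaplaceInverse.lsym N 1 q * (dft N *ᵥ ω) q :=
    funext fun q => B5Momentum130.dft_LapS_apply N 1 ω q
  rw [dot_eq_dot_dft, h, dotProduct]
  push_cast
  refine Finset.sum_congr rfl fun q _ => ?_
  rw [Pi.star_apply, Complex.star_def, lsym_one_eq, ← Complex.conj_mul']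
  ring

/-- **`⟨ω, Δ₀ω⟩² ≤ ‖Δ₀ω‖²·‖ω‖²`** (Cauchy–Schwarz, momentum side). [folklore] -/
private theorem form_LapS_sq_le (ω : Tor N → ℂ) :
    (star ω ⬝ᵥ (LapS N 1 *ᵥ ω)).re ^ 2 ≤ (star (LapS N 1 *ᵥ ω) ⬝ᵥ (LapS N 1 *ᵥ ω)).re * (star ω ⬝ᵥ ω).re := by
  rw [form_LapS_momentum, norm_LapS_sq, norm_sq_eq, Complex.ofReal_re, Complex.ofReal_re, Complex.ofReal_re]
  have h := Finset.sum_mul_sq_le_sq_mul_sq Finset.univ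
    (fun q => Delta1r 0 (sOf N q) * ‖(dft N *ᵥ ω) q‖) (fun q => ‖(dft N *ᵥ ω) q‖)
  have e1 : ∑ q, Delta1r 0 (sOf N q) * ‖(dft N *ᵥ ω) q‖ * ‖(dft N *ᵥ ω) q‖
      = ∑ q, Delta1r 0 (sOf N q) * ‖(dft N *ᵥ ω) q‖ ^ 2 := Finset.sum_congr rfl fun q _ => by ring
  have e2 : ∑ q, (Delta1r 0 (sOf N q) * ‖(dft N *ᵥ ω) q‖) ^ 2
      = ∑ q, Delta1r 0 (sOf N q) ^ 2 * ‖(dft N *ᵥ ω) q‖ ^ 2 := Finset.sum_congr rfl fun q _ => by ring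
  rw [e1, e2] at h
  exact h

end Momentum

/-! ## §3. (2.110) for the typed `Δ′_j` on `Q′₁ω = 0` -/

section Window

variable (n : ℕ) [NeZero n] (k : ℕ) (M : Fin d → ℕ) [hM : ∀ μ, NeZero (M μ)]

/-- **(2.110), LOWER HALF, for the typed `Δ′_j`**: on the unit torus `T = Π_μ ℤ/((k+1)M_μ)` (block size `L = k + 1`), for
every ω with vanishing L-block sums (`Q′₁ω = 0`), `γ₀‖ω‖² ≤ ⟨ω, Δ′_jω⟩` with `γ₀ = c₀(d)·(8/L²)²` — d and L only, uniform in
the fine factor n and in the torus.  Route of the print: Poincaré on `Q′₁ω = 0` then (2.109).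
[cite: Balaban1984PropagatorsII, (2.110) p.242] -/
theorem ineq2110_lower (ω : Tor (fine (k + 1) M) → ℂ)
    (hω : ∀ y : Tor M, ∑ j : Fin d → Fin (k + 1), ω (bpt (k + 1) M y j) = 0) :
    c0_2109 d * (8 / ((k : ℝ) + 1) ^ 2) ^ 2 * (star ω ⬝ᵥ ω).re
      ≤ (star ω ⬝ᵥ (dPOp n (fine (k + 1) M) *ᵥ ω)).re := by
  have h09 := ineq2109_lower (fine (k + 1) M) n ω
  have hP := block_poincare k M ω hω
  have hCS := form_LapS_sq_le (fine (k + 1) M) ω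
  set S0 := (star ω ⬝ᵥ ω).re with hS0
  set S1 := (star ω ⬝ᵥ (LapS (fine (k + 1) M) 1 *ᵥ ω)).re with hS1
  set S2 := (star (LapS (fine (k + 1) M) 1 *ᵥ ω) ⬝ᵥ (LapS (fine (k + 1) M) 1 *ᵥ ω)).re with hS2
  have hS0nn : 0 ≤ S0 := by rw [hS0, norm_sq_eq, Complex.ofReal_re]; exact Finset.sum_nonneg fun q _ => sq_nonneg _
  have hS2nn : 0 ≤ S2 := by
    rw [hS2, norm_LapS_sq, Complex.ofReal_re]
    exact Finset.sum_nonneg fun q _ => mul_nonneg (sq_nonneg _) (sq_nonneg _)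
  have hK : (0 : ℝ) < ((k : ℝ) + 1) ^ 2 := by positivity
  have hc0 := (c0_2109_pos d).le
  -- the Poincaré bound squared and Cauchy–Schwarz: 64·S0 ≤ L⁴·S2
  have hkey : (8 / ((k : ℝ) + 1) ^ 2) ^ 2 * S0 ≤ S2 := by
    rcases hS0nn.eq_or_lt with h0 | h0
    · rw [← h0, mul_zero]; exact hS2nn
    · have h1 : (8 * S0) ^ 2 ≤ (((k : ℝ) + 1) ^ 2 * S1) ^ 2 :=
        pow_le_pow_left₀ (by positivity) hP 2
      have h2 : (((k : ℝ) + 1) ^ 2 * S1) ^ 2 ≤ (((k : ℝ) + 1) ^ 2) ^ 2 * (S2 * S0) := by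
        rw [mul_pow]; exact mul_le_mul_of_nonneg_left hCS (by positivity)
      have h3 : 64 * S0 * S0 ≤ (((k : ℝ) + 1) ^ 2) ^ 2 * S2 * S0 := by nlinarith
      have h4 : 64 * S0 ≤ (((k : ℝ) + 1) ^ 2) ^ 2 * S2 := le_of_mul_le_mul_right h3 h0
      rw [div_pow, div_mul_eq_mul_div, div_le_iff₀ (by positivity)]
      nlinarith
  calc c0_2109 d * (8 / ((k : ℝ) + 1) ^ 2) ^ 2 * S0 = c0_2109 d * ((8 / ((k : ℝ) + 1) ^ 2) ^ 2 * S0) := by ring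
    _ ≤ c0_2109 d * S2 := mul_le_mul_of_nonneg_left hkey hc0
    _ ≤ _ := h09

omit hM in
/-- **(2.110), UPPER HALF**: `⟨ω, Δ′_jω⟩ ≤ γ₁(d)‖ω‖²` (for every ω; from (2.109)). [cite: Balaban1984PropagatorsII, (2.110) p.242] -/
theorem ineq2110_upper [∀ μ, NeZero (M μ)] (ω : Tor (fine (k + 1) M) → ℂ) :
    (star ω ⬝ᵥ (dPOp n (fine (k + 1) M) *ᵥ ω)).re ≤ gamma1_2109 d * (star ω ⬝ᵥ ω).re :=
  (ineq2109_upper (fine (k + 1) M) n ω).trans (ineq2109_top (fine (k + 1) M) ω)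

/-- **(2.110) AS PRINTED, for the typed torus `Δ′_j`**: *"γ₀‖ω‖² ≤ ⟨ω, Δ′_jω⟩ ≤ γ₁‖ω‖² for ω : Q′₁ω = 0, with positive
constants γ₀, γ₁ dependent on d and L only"* — here `γ₀ = c₀(d)·(8/L²)²`, `γ₁ = γ₁(d)`, `L = k + 1`, `Q′₁ = QsOp L M`, for every
fine factor `n` and every torus. [cite: Balaban1984PropagatorsII, (2.110) p.242] -/
theorem ineq2110 (ω : Tor (fine (k + 1) M) → ℂ) (hQ : QsOp (k + 1) M *ᵥ ω = 0) :
    c0_2109 d * (8 / ((k : ℝ) + 1) ^ 2) ^ 2 * (star ω ⬝ᵥ ω).re ≤ (star ω ⬝ᵥ (dPOp n (fine (k + 1) M) *ᵥ ω)).re ∧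
      (star ω ⬝ᵥ (dPOp n (fine (k + 1) M) *ᵥ ω)).re ≤ gamma1_2109 d * (star ω ⬝ᵥ ω).re :=
  ⟨ineq2110_lower n k M ω (blockSum_eq_zero_of_QsOp k M ω hQ), ineq2110_upper n k M ω⟩

omit hM in
/-- the constants of (2.110) are positive and depend on d and L only. [cite: Balaban1984PropagatorsII, (2.110) p.242] [folklore] -/
theorem gamma0_2110_pos : 0 < c0_2109 d * (8 / ((k : ℝ) + 1) ^ 2) ^ 2 :=
  mul_pos (c0_2109_pos d) (by positivity)

end Window

end

end Literature.MathematicalPhysics.QuantumFieldTheory.Balaban1983to89.B6DeltaPrime2110Torus
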